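/-
Copyright: the b2b-balaban T⁴-continuum CRUX team, row NE7b OWNER lineage `t4-ne7b-p1` (gen 124). Project licence.
-/
import Summits.QuantumFields.BalabanUV.T4Continuum.Spine.NE7b.SupZdPerturbedResponseKernel

/-!
# THE PERTURBED INFINITE-VOLUME FLUCTUATION COVARIANCE, POINTWISE: for `V : ℤ^d → [−λ, Λ]` (`d ≥ 3`, every mesh), a kernel
# `|K(p,q)| ≤ εe^{−γ|p − q|₁}` under the three smallness conditions of (218)∕(219), every `b₀` and every `u` of block profile
# `|u(p)| ≤ C_ue^{−μ|blk n p − b₀|₁}` solving `(H_V + K)u = f` ((215)∕(216): THE bounded solution of a block source): its response part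
# `h = Σ′_{b″}m(b″)h^K_{b″}` (`m` = block means of `u`, `h^K_{b″}` = (220)'s perturbed response kernels) converges absolutely, `h` and `u − h`
# decay like `e^{−ν|blk n p − b₀|₁}`, `Q′(u − h) = 0`, and `(H_V + K)(u − h) = f − Σ′_{b″}m(b″)N_K(blk n ·, b″)` — the displays `C_Kf = u − h`,
# `Q′C_K = 0`, `(H_V+K)C_Kf = f − Q′*(coarse)` of the perturbed road's fluctuation covariance
# `C_K = (H+K)⁻¹ − (H+K)⁻¹Q′*(Q′(H+K)⁻¹Q′*)⁻¹Q′(H+K)⁻¹`, on `ℤ^d`; (201)'s `H + K` twin (row NE7b, node U5c; (214)∕(219)∕(220) BY NAME; [folklore])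

Cell `pub-balaban`, sub-cell `t4`, spine estimate NE7b (`T4WeightBudget.RelWeightBound`; the cell's OWN estimate — NOT PRINTED in
[Bałaban 1983–89], NOT PROVED).  Crux-route work under `Spine/NE7b/` by the row OWNER (`t4-ne7b-p1` gen 124, file (221)) under FREEZE
(0)'s crux-prover clause; NOTHING of Bałaban's is named as a Lean object, valued or asserted; no `T4Continuum/Support` leaf typed; no `def`,
no notation (`m`, `h^K_{b″}`, `h`, `C_h = 2C_M′C_ΨK_{μ−ν}` WRITTEN OUT; `M`, `Ψ`, `Ψ^K`, `u` are DATA with their defining properties — the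
block-scale decay of `Ψ^K` and of `u` are HYPOTHESES with free constants `C_Ψ`, `C_u`, discharged by (216) (ii) and (215)∕(216) §1); zero
`sorry`.  Imports (BY NAME): the OWNER's (220) `…SupZdPerturbedResponseKernel` (`zd_perturbed_response_kernel`; through it (214)
`tsum_exp_conv_noLoss`, (189) `summable_exp_l1`, (191) `natAbs_sub_comm_sum`, (27) `mem_B`, `sum_B_const`), Mathlib's `Summable.mul_of_nonneg`,
`Summable.tsum_comm`, `Summable.prod`, `Summable.tsum_finsetSum`, `Summable.tsum_sub`, `norm_tsum_le_tsum_norm`, `tsum_eq_single`.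

WHY (located).  § [NE7bP1-G124-HANDOFF] NEXT (3)(a)∕(b): the `H + K` column on `ℤ^d` now has all three infinite-volume objects of the road
— `G_K` ((213)∕(215)), the next-scale Hessian `(n+1)^dN_K` ((218)∕(219)) with its response `h^K` ((220)), and here the fluctuation
covariance `C_K` — each with exponential decay and constants from `(d, a, λ, Λ)` only, and each `O(ε)`-close to its `K = 0` version where
stated ((216) (iii), (219)).  The proof is (201)'s with two additions forced by the nonlocal term: the kernel rows `Σ′_qK(p,q)(·)(q)` pass
through the response series `Σ′_{b″}m(b″)h^K_{b″}(q)` by Fubini on `ℤ^d × ℤ^d` under `C_ue^{−μ|b₀−b″|₁}C_h·εe^{−γ|p−q|₁}` (§1), and the kernel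
row is split linearly over `u − h` (both rows converge: `u`, `h` bounded, `K`-rows summable).  The decay of `h` is a no-loss convolution
((214), rates `ν < μ`), so the fluctuation part keeps the rate `ν` of `N_K`.

WHAT IS PROVED ([folklore]): §1 **`kernel_row_through_series`** (Fubini for a kernel row against a response series); §2
**`zd_perturbed_fluctuation`** (THE END: `∃ C₀ C_P δ₀ c₁ δ₁ > 0`: for ALL data as in (220): `∃ N` with (219)'s profile and both
identities, and for every `b₀`, `u` of block profile `C_u` solving `(H_V + K)u = f`: summability of the response part, its bound
`C_uC_hK_{μ−ν}e^{−ν|blk n p − b₀|₁}`, (i) `|u − h| ≤ C_u(1 + C_hK_{μ−ν})e^{−ν|blk n p − b₀|₁}`, (ii) zero block means, (iii) the perturbed equation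
with source `f − Σ′m(b″)N_K(blk n ·, b″)`); §3 toy.

HONEST (what this is NOT).  Pointwise displays only: no operator (`ℓ^∞`∕`ℓ²`) packaging of `C_K` ((212)'s twin), no symmetry (none of
`K`, `N_K`, `C_K` is claimed symmetric), no Lipschitz-in-`K` of `C_K`, no torus → `ℤ^d` limit of the `H + K` tower; THREE smallness conditions
with the sup road's constants — NOT (163)'s energy threshold; the LINEAR column only; `d ≥ 3` only; scalar skeleton ((A3), NC-NE7b-α
UNRULED); nothing of the covariant propagators of [B4]–[B6]; nothing of Bałaban's asserted.  BY-NAME EFFECT ON THE WALL: NONE.  NE7b NOT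
PRINTED ∕ NOT PROVED; spine PROVED 0∕9; rung (B)+1 — the programme's measures remain FINITE-torus statements; NOT the mass gap, NOT Clay.
HONEST DEPENDENCY: continuum YM on T⁴ ⇐ BetaPertH ∧ nine spine estimates (0∕9 proved); BetaPertH ⇐ (D1) ∧ (D4) ∧ CAP+tail; G-an2-4
gates asym, D1 and NE2∕3∕4.
-/

set_option autoImplicit false

noncomputable section

namespace Summit.QuantumFields.BalabanUV.T4Continuum.NE7b.SupZdPerturbedCovarianceKernel

open Real Filter Topology
open scoped ENNReal
open Literature.MathematicalPhysics.QuantumFieldTheory.Balaban1983to89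
open B6QGQLower276 (X e blk B mem_B sum_B_const)
open SupZdExponentialSums (summable_exp_l1 tsum_exp_l1_le)
open SupZdCoarseForm (natAbs_sub_comm_sum)
open SupZdProfileNoLoss (tsum_exp_conv_noLoss)
open SupZdPerturbedResponseKernel (zd_perturbed_response_kernel)

variable {d : ℕ}

/-! ## §1. A kernel row through a response series (Fubini on `ℤ^d × ℤ^d`) -/

/-- **KERNEL ROW THROUGH THE RESPONSE SERIES**: `|K(p,q)| ≤ εe^{−γ|p−q|₁}` (`γ > 0`), `|m(b″)| ≤ C_ue^{−μ|b₀−b″|₁}` (`μ > 0`), `|h_{b″}(q)| ≤ C_h`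
⟹ `Σ′_qK(p,q)Σ′_{b″}m(b″)h_{b″}(q) = Σ′_{b″}m(b″)Σ′_qK(p,q)h_{b″}(q)`, the outer series on the right converging absolutely — Fubini under the
product domination `C_ue^{−μ|b₀−b″|₁}C_h·εe^{−γ|p−q|₁}`. [folklore] -/
theorem kernel_row_through_series {ε γ μ Cu Ch : ℝ} (hε : 0 ≤ ε) (hγ : 0 < γ) (hμ : 0 < μ) (hCu : 0 ≤ Cu) (hCh : 0 ≤ Ch)
    (K : X d → X d → ℝ) (hK : ∀ p q, |K p q| ≤ ε * exp (-(γ * ∑ i, (((p i - q i).natAbs : ℕ) : ℝ)))) (b₀ : X d)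
    (mu : X d → ℝ) (hr : X d → X d → ℝ) (hmu : ∀ b'', |mu b''| ≤ Cu * exp (-(μ * ∑ i, (((b₀ i - b'' i).natAbs : ℕ) : ℝ))))
    (hrb : ∀ b'' q, |hr b'' q| ≤ Ch) (p : X d) :
    Summable (fun b'' : X d => mu b'' * ∑' q : X d, K p q * hr b'' q) ∧
    ∑' q : X d, K p q * ∑' b'' : X d, mu b'' * hr b'' q = ∑' b'' : X d, mu b'' * ∑' q : X d, K p q * hr b'' q := by
  obtain ⟨F, hF⟩ : ∃ F : X d → X d → ℝ, ∀ b'' q, F b'' q = K p q * (mu b'' * hr b'' q) := ⟨_, fun _ _ => rfl⟩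
  have hprod : Summable fun x : X d × X d => (Cu * exp (-(μ * ∑ i, (((b₀ i - x.1 i).natAbs : ℕ) : ℝ))) * Ch)
      * (ε * exp (-(γ * ∑ i, (((p i - x.2 i).natAbs : ℕ) : ℝ)))) :=
    Summable.mul_of_nonneg (((summable_exp_l1 hμ b₀).mul_left Cu).mul_right Ch) ((summable_exp_l1 hγ p).mul_left ε)
      (fun _ => by positivity) (fun _ => by positivity)
  have hFsum : Summable (Function.uncurry F) := Summable.of_norm_bounded hprod fun x => by
    simp only [Function.uncurry, hF, Real.norm_eq_abs]
    rw [abs_mul, abs_mul, mul_comm]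
    exact mul_le_mul (mul_le_mul (hmu x.1) (hrb x.1 x.2) (abs_nonneg _) (by positivity)) (hK p x.2) (abs_nonneg _) (by positivity)
  have hrowq : ∀ b'', ∑' q : X d, F b'' q = mu b'' * ∑' q : X d, K p q * hr b'' q := fun b'' => by
    rw [← tsum_mul_left]; exact tsum_congr fun q => by rw [hF]; ring
  refine ⟨?_, ?_⟩
  · have h := hFsum.prod
    simp only [Function.uncurry] at h
    exact h.congr fun b'' => hrowq b''
  · have e1 : ∀ q, K p q * ∑' b'' : X d, mu b'' * hr b'' q = ∑' b'' : X d, F b'' q := fun q => by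
      rw [← tsum_mul_left]; exact tsum_congr fun b'' => by rw [hF]
    rw [tsum_congr e1, hFsum.tsum_comm, tsum_congr hrowq]

/-! ## §2. THE END: the fluctuation part of a decaying solution of the perturbed equation -/

/-- **HEADLINE — THE PERTURBED INFINITE-VOLUME FLUCTUATION COVARIANCE, POINTWISE**: under the hypotheses of (220) (`d ≥ 3`, the road,
unperturbed block columns `Ψ`, a cube limit `M`, `ε, γ, μ, ν` with the three smallness conditions, a kernel `K` of the class, perturbed block
columns `Ψ^K` with block-scale decay constant `C_Ψ`): with (219)'s `N_K` (re-exported) and (220)'s response kernels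
`h^K_{b″} = Σ′_{b′}N_K(b′,b″)Ψ^K_{b′}`, for every `b₀` and every `u` with `|u(p)| ≤ C_ue^{−μ|blk n p − b₀|₁}` solving `(H_V + K)u = f` ((215)∕(216)
supply THE bounded solution of a block source with `C_u = 2C_PK_{δ₀−μ}M_f`): with the block means `m(b″) = (n+1)^{−d}Σ_{B n b″}u` and the response
part `h = Σ′_{b″}m(b″)h^K_{b″}`, the series converges absolutely and (i) `|h(p)|, |u(p) − h(p)| ≤ C·e^{−ν|blk n p − b₀|₁}` with
`C = C_u(1 + 2C_M′C_ΨK_{μ−ν}²)` explicit; (ii) `Q′(u − h) = 0`; (iii) `(H_V + K)(u − h) = f − Σ′_{b″}m(b″)N_K(blk n ·, b″)` — the displays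
`C_Kf = u − h`, `Q′C_K = 0`, `(H+K)C_Kf = f − Q′*(coarse)` of the perturbed road's fluctuation covariance, on `ℤ^d` ((201)'s `H + K` twin; the
kernel rows pass through the response series by Fubini on `ℤ^d × ℤ^d`). [folklore] -/
theorem zd_perturbed_fluctuation (hd : 3 ≤ d) (a : ℝ) (ha : 0 < a) {lam Lam : ℝ} (hlam : lam < min 2 a) (hLam : 0 ≤ Lam) :
    ∃ C₀ CP δ₀ c₁ δ₁ : ℝ, 0 < C₀ ∧ 0 < CP ∧ 0 < δ₀ ∧ 0 < c₁ ∧ 0 < δ₁ ∧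
    ∀ (n : ℕ) (V : X d → ℝ), (∀ p, -lam ≤ V p) → (∀ p, V p ≤ Lam) →
    ∀ (Ψ : X d → X d → ℝ) (BΨ : X d → ℝ), (∀ c p, |Ψ c p| ≤ BΨ c) →
      (∀ c p, ((n : ℝ) + 1) ^ 2 * ∑ μ', (2 * Ψ c p - Ψ c (p + e μ') - Ψ c (p - e μ'))
        + a / ((n : ℝ) + 1) ^ d * ∑ q ∈ B n (blk n p), Ψ c q + V p * Ψ c p = if blk n p = c then 1 else 0) →
    ∀ (M : X d → X d → ℝ), (∀ b b' : X d, Tendsto (fun R : ℕ =>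
      if h : b ∈ (Fintype.piFinset fun _ : Fin d => Finset.Icc (-(R : ℤ)) R) ∧
          b' ∈ (Fintype.piFinset fun _ : Fin d => Finset.Icc (-(R : ℤ)) R)
        then (Matrix.of fun c c' : ↥(Fintype.piFinset fun _ : Fin d => Finset.Icc (-(R : ℤ)) R) =>
          (((n : ℝ) + 1) ^ d)⁻¹ * ∑ q ∈ B n (c : X d), Ψ (c' : X d) q)⁻¹ ⟨b, h.1⟩ ⟨b', h.2⟩ else 0)
      atTop (𝓝 (M b b'))) →
    ∀ (ε γ μ ν : ℝ), 0 ≤ ε → 0 < μ → μ < δ₀ → μ < γ → 0 < ν → ν < μ → ν < δ₁ →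
      ε * (2 * (1 - exp (-γ))⁻¹) ^ d * C₀ ≤ 1 / 2 →
      (CP * (2 * (1 - exp (-(δ₀ - μ)))⁻¹) ^ d) * (ε * exp (μ * d) * (2 * (1 - exp (-(γ - μ)))⁻¹) ^ d) ≤ 1 / 2 →
      (c₁ * exp (ν * d) * (2 * (1 - exp (-(δ₁ - ν)))⁻¹) ^ d)
        * ((4 * (CP * (2 * (1 - exp (-(δ₀ - μ)))⁻¹) ^ d)
            * ((CP * (2 * (1 - exp (-(δ₀ - μ)))⁻¹) ^ d) * (ε * exp (μ * d) * (2 * (1 - exp (-(γ - μ)))⁻¹) ^ d)))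
          * exp (ν * d) * (2 * (1 - exp (-(μ - ν)))⁻¹) ^ d) ≤ 1 / 2 →
    ∀ (K : X d → X d → ℝ), (∀ p q, |K p q| ≤ ε * exp (-(γ * ∑ i, (((p i - q i).natAbs : ℕ) : ℝ)))) →
    ∀ (ΨK : X d → X d → ℝ) (BΨK : X d → ℝ), (∀ c p, |ΨK c p| ≤ BΨK c) →
      (∀ c p, ((n : ℝ) + 1) ^ 2 * ∑ μ', (2 * ΨK c p - ΨK c (p + e μ') - ΨK c (p - e μ'))
        + a / ((n : ℝ) + 1) ^ d * ∑ q ∈ B n (blk n p), ΨK c q + V p * ΨK c p + ∑' q : X d, K p q * ΨK c q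
          = if blk n p = c then 1 else 0) →
    ∀ (CΨ : ℝ), (∀ c p, |ΨK c p| ≤ CΨ * exp (-(μ * ∑ i, (((blk n p i - c i).natAbs : ℕ) : ℝ)))) →
    ∃ N : X d → X d → ℝ,
      (∀ b c, |N b c| ≤ 2 * (c₁ * exp (ν * d) * (2 * (1 - exp (-(δ₁ - ν)))⁻¹) ^ d) * exp (-(ν * ∑ i, (((b i - c i).natAbs : ℕ) : ℝ)))) ∧
      (∀ b c, Summable (fun b' : X d => ((((n : ℝ) + 1) ^ d)⁻¹ * ∑ q ∈ B n b, ΨK b' q) * N b' c) ∧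
        ∑' b' : X d, ((((n : ℝ) + 1) ^ d)⁻¹ * ∑ q ∈ B n b, ΨK b' q) * N b' c = if b = c then 1 else 0) ∧
      (∀ b c, Summable (fun b' : X d => N b b' * ((((n : ℝ) + 1) ^ d)⁻¹ * ∑ q ∈ B n b', ΨK c q)) ∧
        ∑' b' : X d, N b b' * ((((n : ℝ) + 1) ^ d)⁻¹ * ∑ q ∈ B n b', ΨK c q) = if b = c then 1 else 0) ∧
      ∀ (b₀ : X d) (u : X d → ℝ) (Cu : ℝ), (∀ p, |u p| ≤ Cu * exp (-(μ * ∑ i, (((blk n p i - b₀ i).natAbs : ℕ) : ℝ)))) →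
      ∀ (f : X d → ℝ), (∀ p, ((n : ℝ) + 1) ^ 2 * ∑ μ', (2 * u p - u (p + e μ') - u (p - e μ'))
        + a / ((n : ℝ) + 1) ^ d * ∑ q ∈ B n (blk n p), u q + V p * u p + ∑' q : X d, K p q * u q = f p) →
        (∀ p, Summable fun b'' : X d =>
          ((((n : ℝ) + 1) ^ d)⁻¹ * ∑ q ∈ B n b'', u q) * ∑' b' : X d, N b' b'' * ΨK b' p) ∧
        (∀ p, |∑' b'' : X d, ((((n : ℝ) + 1) ^ d)⁻¹ * ∑ q ∈ B n b'', u q) * ∑' b' : X d, N b' b'' * ΨK b' p|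
          ≤ Cu * (2 * (c₁ * exp (ν * d) * (2 * (1 - exp (-(δ₁ - ν)))⁻¹) ^ d) * CΨ * (2 * (1 - exp (-(μ - ν)))⁻¹) ^ d)
            * (2 * (1 - exp (-(μ - ν)))⁻¹) ^ d * exp (-(ν * ∑ i, (((blk n p i - b₀ i).natAbs : ℕ) : ℝ)))) ∧
        (∀ p, |u p - ∑' b'' : X d, ((((n : ℝ) + 1) ^ d)⁻¹ * ∑ q ∈ B n b'', u q) * ∑' b' : X d, N b' b'' * ΨK b' p|
          ≤ Cu * (1 + (2 * (c₁ * exp (ν * d) * (2 * (1 - exp (-(δ₁ - ν)))⁻¹) ^ d) * CΨ * (2 * (1 - exp (-(μ - ν)))⁻¹) ^ d)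
            * (2 * (1 - exp (-(μ - ν)))⁻¹) ^ d) * exp (-(ν * ∑ i, (((blk n p i - b₀ i).natAbs : ℕ) : ℝ)))) ∧
        (∀ b, (((n : ℝ) + 1) ^ d)⁻¹ * ∑ q ∈ B n b,
          (u q - ∑' b'' : X d, ((((n : ℝ) + 1) ^ d)⁻¹ * ∑ q' ∈ B n b'', u q') * ∑' b' : X d, N b' b'' * ΨK b' q) = 0) ∧
        (∀ p, ((n : ℝ) + 1) ^ 2 * ∑ μ',
            (2 * (u p - ∑' b'' : X d, ((((n : ℝ) + 1) ^ d)⁻¹ * ∑ q ∈ B n b'', u q) * ∑' b' : X d, N b' b'' * ΨK b' p)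
            - (u (p + e μ') - ∑' b'' : X d, ((((n : ℝ) + 1) ^ d)⁻¹ * ∑ q ∈ B n b'', u q) * ∑' b' : X d, N b' b'' * ΨK b' (p + e μ'))
            - (u (p - e μ') - ∑' b'' : X d, ((((n : ℝ) + 1) ^ d)⁻¹ * ∑ q ∈ B n b'', u q) * ∑' b' : X d, N b' b'' * ΨK b' (p - e μ')))
          + a / ((n : ℝ) + 1) ^ d * ∑ q ∈ B n (blk n p),
            (u q - ∑' b'' : X d, ((((n : ℝ) + 1) ^ d)⁻¹ * ∑ q' ∈ B n b'', u q') * ∑' b' : X d, N b' b'' * ΨK b' q)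
          + V p * (u p - ∑' b'' : X d, ((((n : ℝ) + 1) ^ d)⁻¹ * ∑ q ∈ B n b'', u q) * ∑' b' : X d, N b' b'' * ΨK b' p)
          + ∑' q : X d, K p q * (u q - ∑' b'' : X d, ((((n : ℝ) + 1) ^ d)⁻¹ * ∑ q' ∈ B n b'', u q') * ∑' b' : X d, N b' b'' * ΨK b' q)
          = f p - ∑' b'' : X d, ((((n : ℝ) + 1) ^ d)⁻¹ * ∑ q ∈ B n b'', u q) * N (blk n p) b'') := by
  classical
  obtain ⟨C₀, CP, δ₀, c₁, δ₁, hC₀, hCP, hδ₀, hc₁, hδ₁, H220⟩ := zd_perturbed_response_kernel (d := d) hd a ha hlam hLam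
  refine ⟨C₀, CP, δ₀, c₁, δ₁, hC₀, hCP, hδ₀, hc₁, hδ₁, ?_⟩
  intro n V hV hV' Ψ BΨ hΨB hΨ M hM ε γ μ ν hε hμ hμδ hμγ hν hνμ hνδ hsmall1 hsmall2 hsmall3 K hK ΨK BΨK hΨKB hΨK CΨ hΨKd
  obtain ⟨N, hNd, hright, hleft, hresp⟩ :=
    H220 n V hV hV' Ψ BΨ hΨB hΨ M hM ε γ μ ν hε hμ hμδ hμγ hν hνμ hνδ hsmall1 hsmall2 hsmall3 K hK ΨK BΨK hΨKB hΨK CΨ hΨKd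
  refine ⟨N, hNd, hright, hleft, fun b₀ u Cu hud f hu => ?_⟩
  have hγ : 0 < γ := lt_trans hμ hμγ
  have hvol : (0 : ℝ) < ((n : ℝ) + 1) ^ d := by positivity
  have hKν : 0 < (2 * (1 - exp (-(δ₁ - ν)))⁻¹) ^ d := pow_pos (mul_pos two_pos (inv_pos.2 (sub_pos.2 (exp_lt_one_iff.2 (by linarith))))) d
  have hKμν : 0 < (2 * (1 - exp (-(μ - ν)))⁻¹) ^ d := pow_pos (mul_pos two_pos (inv_pos.2 (sub_pos.2 (exp_lt_one_iff.2 (by linarith))))) d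
  have hCu : 0 ≤ Cu := by
    have h := (abs_nonneg _).trans (hud 0)
    exact le_of_mul_le_mul_right (by rw [zero_mul]; exact h) (exp_pos _)
  have hCΨ : 0 ≤ CΨ := by
    have h := (abs_nonneg _).trans (hΨKd b₀ 0)
    exact le_of_mul_le_mul_right (by rw [zero_mul]; exact h) (exp_pos _)
  -- the response constant
  obtain ⟨Ch, hCh⟩ : ∃ Ch : ℝ, Ch = 2 * (c₁ * exp (ν * d) * (2 * (1 - exp (-(δ₁ - ν)))⁻¹) ^ d) * CΨ
      * (2 * (1 - exp (-(μ - ν)))⁻¹) ^ d := ⟨_, rfl⟩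
  have hCh0 : 0 ≤ Ch := by rw [hCh]; positivity
  rw [← hCh]
  -- abbreviations: block means of `u` and the response kernels
  obtain ⟨mu, hmu⟩ : ∃ mu : X d → ℝ, ∀ b'', mu b'' = (((n : ℝ) + 1) ^ d)⁻¹ * ∑ q ∈ B n b'', u q := ⟨_, fun _ => rfl⟩
  obtain ⟨hr, hhr⟩ : ∃ hr : X d → X d → ℝ, ∀ b'' p, hr b'' p = ∑' b' : X d, N b' b'' * ΨK b' p := ⟨_, fun _ _ => rfl⟩
  -- decay of the block means of `u` and of the response kernels ((220) (i))
  have hmud : ∀ b'', |mu b''| ≤ Cu * exp (-(μ * ∑ i, (((b'' i - b₀ i).natAbs : ℕ) : ℝ))) := by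
    intro b''
    rw [hmu, abs_mul, abs_inv, abs_of_pos hvol, inv_mul_le_iff₀ hvol]
    calc |∑ q ∈ B n b'', u q| ≤ ∑ q ∈ B n b'', |u q| := Finset.abs_sum_le_sum_abs _ _
      _ ≤ ∑ _q ∈ B n b'', Cu * exp (-(μ * ∑ i, (((b'' i - b₀ i).natAbs : ℕ) : ℝ))) :=
          Finset.sum_le_sum fun q hq => by have h := hud q; rw [mem_B.1 hq] at h; exact h
      _ = _ := sum_B_const _ _
  have hrd : ∀ b'' p, |hr b'' p| ≤ Ch * exp (-(ν * ∑ i, (((blk n p i - b'' i).natAbs : ℕ) : ℝ))) := fun b'' p => by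
    rw [hhr, hCh]; exact (hresp b'').2.1 p
  have hrb : ∀ b'' p, |hr b'' p| ≤ Ch := fun b'' p =>
    (hrd b'' p).trans (mul_le_of_le_one_right hCh0 (exp_le_one_iff.2 (neg_nonpos.2 (by positivity))))
  -- the response part: termwise domination by a no-loss convolution (rates `ν < μ`), absolute convergence, decay
  have hdom : ∀ p b'', |mu b'' * hr b'' p| ≤ Cu * Ch * (exp (-(μ * ∑ i, (((b₀ i - b'' i).natAbs : ℕ) : ℝ)))
      * exp (-(ν * ∑ i, (((b'' i - blk n p i).natAbs : ℕ) : ℝ)))) := fun p b'' => by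
    rw [abs_mul, natAbs_sub_comm_sum b₀ b'', natAbs_sub_comm_sum b'' (blk n p)]
    calc |mu b''| * |hr b'' p| ≤ (Cu * exp (-(μ * ∑ i, (((b'' i - b₀ i).natAbs : ℕ) : ℝ))))
          * (Ch * exp (-(ν * ∑ i, (((blk n p i - b'' i).natAbs : ℕ) : ℝ)))) :=
          mul_le_mul (hmud b'') (hrd b'' p) (abs_nonneg _) (by positivity)
      _ = _ := by ring
  have hs : ∀ p, Summable fun b'' : X d => mu b'' * hr b'' p := fun p =>
    Summable.of_norm_bounded (((tsum_exp_conv_noLoss hν.le hνμ (blk n p) b₀).1).mul_left (Cu * Ch)) fun b'' => by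
      rw [Real.norm_eq_abs]; exact hdom p b''
  have hhd : ∀ p, |∑' b'' : X d, mu b'' * hr b'' p| ≤ Cu * Ch * (2 * (1 - exp (-(μ - ν)))⁻¹) ^ d
      * exp (-(ν * ∑ i, (((blk n p i - b₀ i).natAbs : ℕ) : ℝ))) := by
    intro p
    obtain ⟨hcs, hcb⟩ := tsum_exp_conv_noLoss (d := d) hν.le hνμ (blk n p) b₀
    have h1 : |∑' b'' : X d, mu b'' * hr b'' p| ≤ ∑' b'' : X d, |mu b'' * hr b'' p| := by
      have := norm_tsum_le_tsum_norm (hs p).norm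
      simpa only [Real.norm_eq_abs] using this
    have h2 := (hs p).abs.tsum_le_tsum (hdom p) (hcs.mul_left (Cu * Ch))
    rw [Summable.tsum_mul_left _ hcs] at h2
    have h3 := mul_le_mul_of_nonneg_left hcb (show 0 ≤ Cu * Ch by positivity)
    rw [natAbs_sub_comm_sum b₀ (blk n p)] at h3
    calc |∑' b'' : X d, mu b'' * hr b'' p| ≤ Cu * Ch * ((2 * (1 - exp (-(μ - ν)))⁻¹) ^ d
          * exp (-(ν * ∑ i, (((blk n p i - b₀ i).natAbs : ℕ) : ℝ)))) := h1.trans (h2.trans h3)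
      _ = _ := by ring
  -- fold the displays
  have efold : ∀ p b'', ((((n : ℝ) + 1) ^ d)⁻¹ * ∑ q ∈ B n b'', u q) * ∑' b' : X d, N b' b'' * ΨK b' p
      = mu b'' * hr b'' p := fun p b'' => by rw [hmu, hhr]
  simp only [efold]
  refine ⟨hs, hhd, fun p => ?_, fun b => ?_, fun p => ?_⟩
  · -- (i) decay of the fluctuation part
    have e1 : |u p| ≤ Cu * exp (-(ν * ∑ i, (((blk n p i - b₀ i).natAbs : ℕ) : ℝ))) :=
      (hud p).trans (mul_le_mul_of_nonneg_left (exp_le_exp.2 (by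
        nlinarith [show (0:ℝ) ≤ ∑ i, (((blk n p i - b₀ i).natAbs : ℕ) : ℝ) by positivity])) hCu)
    calc |u p - ∑' b'' : X d, mu b'' * hr b'' p| ≤ |u p| + |∑' b'' : X d, mu b'' * hr b'' p| := abs_sub _ _
      _ ≤ Cu * exp (-(ν * ∑ i, (((blk n p i - b₀ i).natAbs : ℕ) : ℝ)))
          + Cu * Ch * (2 * (1 - exp (-(μ - ν)))⁻¹) ^ d * exp (-(ν * ∑ i, (((blk n p i - b₀ i).natAbs : ℕ) : ℝ))) :=
          add_le_add e1 (hhd p)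
      _ = _ := by ring
  · -- (ii) zero block means: the block means of the response part are those of `u`
    have hmean : (((n : ℝ) + 1) ^ d)⁻¹ * ∑ q ∈ B n b, ∑' b'' : X d, mu b'' * hr b'' q = mu b := by
      rw [← Summable.tsum_finsetSum (fun q _ => hs q), ← Summable.tsum_mul_left _ (summable_sum fun q _ => hs q)]
      have e1 : ∀ b'' : X d, (((n : ℝ) + 1) ^ d)⁻¹ * ∑ q ∈ B n b, mu b'' * hr b'' q = mu b'' * (if b = b'' then 1 else 0) := by
        intro b''
        rw [← (hresp b'').2.2.1 b, Finset.mul_sum, Finset.mul_sum, Finset.mul_sum]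
        exact Finset.sum_congr rfl fun q _ => by rw [hhr]; ring
      simp only [e1]
      rw [tsum_eq_single b (fun b'' hb'' => by rw [if_neg (Ne.symm hb''), mul_zero]), if_pos rfl, mul_one]
    rw [Finset.sum_sub_distrib, mul_sub, hmean, hmu, sub_self]
  · -- (iii) the equation
    -- the kernel rows through the response series (§1)
    have hmud' : ∀ b'', |mu b''| ≤ Cu * exp (-(μ * ∑ i, (((b₀ i - b'' i).natAbs : ℕ) : ℝ))) := fun b'' => by
      rw [natAbs_sub_comm_sum]; exact hmud b''
    obtain ⟨hSK, hKrow⟩ := kernel_row_through_series (d := d) hε hγ hμ hCu hCh0 K hK b₀ mu hr hmud' hrb p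
    -- the stencil of `H_V + K` through `Σ′_{b″}` ((220) (iii) termwise), and linearity
    have hpt : ∑' b'' : X d, (((n : ℝ) + 1) ^ 2 * ∑ μ', (2 * (mu b'' * hr b'' p) - mu b'' * hr b'' (p + e μ') - mu b'' * hr b'' (p - e μ'))
        + a / ((n : ℝ) + 1) ^ d * ∑ q ∈ B n (blk n p), mu b'' * hr b'' q + V p * (mu b'' * hr b'' p)
        + mu b'' * ∑' q : X d, K p q * hr b'' q)
        = ∑' b'' : X d, mu b'' * N (blk n p) b'' := by
      refine tsum_congr fun b'' => ?_
      have h3 := (hresp b'').2.2.2 p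
      simp only [← hhr] at h3
      rw [← h3, ← Finset.mul_sum]
      have e2 : ∑ μ', (2 * (mu b'' * hr b'' p) - mu b'' * hr b'' (p + e μ') - mu b'' * hr b'' (p - e μ'))
          = mu b'' * ∑ μ', (2 * hr b'' p - hr b'' (p + e μ') - hr b'' (p - e μ')) := by
        rw [Finset.mul_sum]; exact Finset.sum_congr rfl fun μ' _ => by ring
      rw [e2]
      ring
    have hS1 : ∀ μ' : Fin d, Summable fun b'' : X d =>
        2 * (mu b'' * hr b'' p) - mu b'' * hr b'' (p + e μ') - mu b'' * hr b'' (p - e μ') :=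
      fun μ' => (((hs p).mul_left 2).sub (hs (p + e μ'))).sub (hs (p - e μ'))
    have hS1s : Summable fun b'' : X d =>
        ∑ μ', (2 * (mu b'' * hr b'' p) - mu b'' * hr b'' (p + e μ') - mu b'' * hr b'' (p - e μ')) :=
      summable_sum fun μ' _ => hS1 μ'
    have hS2 : Summable fun b'' : X d => ∑ q ∈ B n (blk n p), mu b'' * hr b'' q := summable_sum fun q _ => hs q
    have hT1 : ∑' b'' : X d, ∑ μ', (2 * (mu b'' * hr b'' p) - mu b'' * hr b'' (p + e μ') - mu b'' * hr b'' (p - e μ'))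
        = ∑ μ', (2 * (∑' b'' : X d, mu b'' * hr b'' p) - (∑' b'' : X d, mu b'' * hr b'' (p + e μ'))
          - (∑' b'' : X d, mu b'' * hr b'' (p - e μ'))) := by
      rw [Summable.tsum_finsetSum fun μ' _ => hS1 μ']
      refine Finset.sum_congr rfl fun μ' _ => ?_
      rw [(((hs p).mul_left 2).sub (hs (p + e μ'))).tsum_sub (hs (p - e μ')), ((hs p).mul_left 2).tsum_sub (hs (p + e μ')),
        (hs p).tsum_mul_left 2]
    have hT2 : ∑' b'' : X d, ∑ q ∈ B n (blk n p), mu b'' * hr b'' q = ∑ q ∈ B n (blk n p), ∑' b'' : X d, mu b'' * hr b'' q :=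
      Summable.tsum_finsetSum fun q _ => hs q
    have hmain : ∑' b'' : X d, (((n : ℝ) + 1) ^ 2 * ∑ μ', (2 * (mu b'' * hr b'' p) - mu b'' * hr b'' (p + e μ')
          - mu b'' * hr b'' (p - e μ'))
        + a / ((n : ℝ) + 1) ^ d * ∑ q ∈ B n (blk n p), mu b'' * hr b'' q + V p * (mu b'' * hr b'' p)
        + mu b'' * ∑' q : X d, K p q * hr b'' q)
        = ((n : ℝ) + 1) ^ 2 * ∑' b'' : X d, ∑ μ', (2 * (mu b'' * hr b'' p) - mu b'' * hr b'' (p + e μ')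
            - mu b'' * hr b'' (p - e μ'))
          + a / ((n : ℝ) + 1) ^ d * ∑' b'' : X d, ∑ q ∈ B n (blk n p), mu b'' * hr b'' q
          + V p * ∑' b'' : X d, mu b'' * hr b'' p + ∑' b'' : X d, mu b'' * ∑' q : X d, K p q * hr b'' q := by
      rw [Summable.tsum_add (((hS1s.mul_left _).add (hS2.mul_left _)).add ((hs p).mul_left _)) hSK,
        Summable.tsum_add ((hS1s.mul_left _).add (hS2.mul_left _)) ((hs p).mul_left _),
        Summable.tsum_add (hS1s.mul_left _) (hS2.mul_left _), hS1s.tsum_mul_left (((n : ℝ) + 1) ^ 2),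
        hS2.tsum_mul_left (a / ((n : ℝ) + 1) ^ d), (hs p).tsum_mul_left (V p)]
    -- `(H_V + K)h = Σ′ m(b″)N(blk n p, b″)`
    have hHh : ((n : ℝ) + 1) ^ 2 * ∑ μ', (2 * (∑' b'' : X d, mu b'' * hr b'' p) - (∑' b'' : X d, mu b'' * hr b'' (p + e μ'))
          - (∑' b'' : X d, mu b'' * hr b'' (p - e μ')))
        + a / ((n : ℝ) + 1) ^ d * ∑ q ∈ B n (blk n p), (∑' b'' : X d, mu b'' * hr b'' q) + V p * (∑' b'' : X d, mu b'' * hr b'' p)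
        + ∑' q : X d, K p q * ∑' b'' : X d, mu b'' * hr b'' q
        = ∑' b'' : X d, mu b'' * N (blk n p) b'' := by rw [← hpt, hmain, hT1, hT2, hKrow]
    -- the kernel row is linear on `u − h`: both pieces converge
    have hub : ∀ q, |u q| ≤ Cu := fun q =>
      (hud q).trans (mul_le_of_le_one_right hCu (exp_le_one_iff.2 (neg_nonpos.2 (by positivity))))
    have hhb : ∀ q, |∑' b'' : X d, mu b'' * hr b'' q| ≤ Cu * Ch * (2 * (1 - exp (-(μ - ν)))⁻¹) ^ d := fun q =>
      (hhd q).trans (mul_le_of_le_one_right (by positivity) (exp_le_one_iff.2 (neg_nonpos.2 (by positivity))))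
    have hsKu : Summable fun q : X d => K p q * u q :=
      Summable.of_norm_bounded (((summable_exp_l1 hγ p).mul_left ε).mul_right Cu) fun q => by
        rw [Real.norm_eq_abs, abs_mul]; exact mul_le_mul (hK p q) (hub q) (abs_nonneg _) (by positivity)
    have hsKh : Summable fun q : X d => K p q * ∑' b'' : X d, mu b'' * hr b'' q :=
      Summable.of_norm_bounded (((summable_exp_l1 hγ p).mul_left ε).mul_right (Cu * Ch * (2 * (1 - exp (-(μ - ν)))⁻¹) ^ d))
        fun q => by
        rw [Real.norm_eq_abs, abs_mul]; exact mul_le_mul (hK p q) (hhb q) (abs_nonneg _) (by positivity)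
    have hKsub : ∑' q : X d, K p q * (u q - ∑' b'' : X d, mu b'' * hr b'' q)
        = ∑' q : X d, K p q * u q - ∑' q : X d, K p q * ∑' b'' : X d, mu b'' * hr b'' q := by
      rw [← hsKu.tsum_sub hsKh]; exact tsum_congr fun q => by ring
    have efold2 : (fun b'' : X d => ((((n : ℝ) + 1) ^ d)⁻¹ * ∑ q ∈ B n b'', u q) * N (blk n p) b'') = fun b'' => mu b'' * N (blk n p) b'' :=
      funext fun b'' => by rw [hmu]
    rw [efold2, ← hHh, ← hu p, hKsub]
    have e1 : ∑ μ', (2 * (u p - ∑' b'' : X d, mu b'' * hr b'' p) - (u (p + e μ') - ∑' b'' : X d, mu b'' * hr b'' (p + e μ'))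
        - (u (p - e μ') - ∑' b'' : X d, mu b'' * hr b'' (p - e μ')))
        = ∑ μ', (2 * u p - u (p + e μ') - u (p - e μ')) - ∑ μ', (2 * (∑' b'' : X d, mu b'' * hr b'' p)
          - (∑' b'' : X d, mu b'' * hr b'' (p + e μ')) - (∑' b'' : X d, mu b'' * hr b'' (p - e μ'))) := by
      rw [← Finset.sum_sub_distrib]; exact Finset.sum_congr rfl fun μ' _ => by ring
    have e2 : ∑ q ∈ B n (blk n p), (u q - ∑' b'' : X d, mu b'' * hr b'' q)
        = ∑ q ∈ B n (blk n p), u q - ∑ q ∈ B n (blk n p), ∑' b'' : X d, mu b'' * hr b'' q :=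
      Finset.sum_sub_distrib (f := fun q => u q) (g := fun q => ∑' b'' : X d, mu b'' * hr b'' q)
    rw [e1, e2]
    ring

/-! ## §3. Toy -/

/-- Toy (`d = 3`, `a = 1`, `λ = 0`, `Λ = 1`): the five constants of the perturbed fluctuation estimate exist. -/
example : ∃ C₀ CP δ₀ c₁ δ₁ : ℝ, 0 < C₀ ∧ 0 < CP ∧ 0 < δ₀ ∧ 0 < c₁ ∧ 0 < δ₁ :=
  let ⟨C₀, CP, δ₀, c₁, δ₁, h1, h2, h3, h4, h5, _⟩ :=
    zd_perturbed_fluctuation (d := 3) le_rfl 1 one_pos (lam := 0) (Lam := 1)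
      (by rw [min_eq_right (by norm_num : (1 : ℝ) ≤ 2)]; norm_num) zero_le_one
  ⟨C₀, CP, δ₀, c₁, δ₁, h1, h2, h3, h4, h5⟩

end Summit.QuantumFields.BalabanUV.T4Continuum.NE7b.SupZdPerturbedCovarianceKernel
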